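import Mathlib.Topology.Homeomorph.Lemmas
import Mathlib.Topology.IsLocalHomeomorph
import Literature.AlgebraicGeometry.HodgeTheory.CompactBallQuotient
import HarnessLib

/-!
# Ball quotients off a closed set: smooth varieties containing `Γ \ 𝔹ⁿ` as the complement of `Z`

Family `hodge`, layer `Literature/AlgebraicGeometry/HodgeTheory`. Requested definition
(`defn-HodgeModel.IsBallCoveredOff`) for route `EisensteinMiddleThird` of the Hodge summit, whose
items `EisensteinTowerHodge`, `LevelThreeMiddleAlgebraic`, `TowerMiddleAlgebraic`,
`LevelThreeCanonicalForms` carry INLINE the hypothesis "`(X ∖ Z)^an` is uniformised by the unit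
ball `𝔹ⁿ` with deck relation generated by a set `S` of matrices"; this file names it, next to
`HodgeModel.IsBallCovered` / `IsCompactBallQuotient` (file `CompactBallQuotient`, the COMPACT case
`Z = ∅` of route `SiuRepresentability`).

**Setting (non-compact arithmetic ball quotients and their smooth compactifications).** Let
`L` be a hermitian lattice of signature `(1, n)` over the integers of an imaginary quadratic field,
`J = diag(1, −1, …, −1)` its form in an orthogonal basis (Allcock–Freitag (2.1):
`⟨a, b⟩ = ā₀b₀ − ā₁b₁ − ⋯ − ā₄b₄` on the Eisenstein lattice `𝓔^{1,4}`). The positive points of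
`P(L ⊗ ℂ)` form an open `n`-ball `𝓑(L)`, the complex hyperbolic space of `L`, on which `Aut(L)`
acts properly discontinuously through the projective-linear action; "any element of `𝓑(Λ)` has a
unique representative `z ∈ ℂ^{1,4}` whose `z₀`-component is `1`. Considering the remaining
coordinates identifies `𝓑(Λ)` with the set of all `(z₁, …, z₄) ∈ ℂ⁴` satisfying
`|z₁|² + ⋯ + |z₄|² < 1`" (Allcock–Freitag §3, (3.1)); the quotient of `𝓑(L)` by a finite-index
subgroup `Γ ⊆ Aut(L)` is a quasi-projective variety (Baily–Borel), NON-compact as soon as `L` has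
isotropic vectors (cusps), e.g. `Aut(𝓔^{1,4}) \ 𝓑⁴` = the moduli space of smooth cubic surfaces
(Allcock–Carlson–Toledo). In the chart `z₀ = 1` the action of a matrix `γ = (γᵢⱼ)_{0 ≤ i,j ≤ n}`
reads `γ · z = w` with `wᵢ = (γᵢ₀ + ∑ⱼ γᵢⱼ zⱼ) / (γ₀₀ + ∑ⱼ γ₀ⱼ zⱼ)` (`1 ≤ i ≤ n`), i.e.
`(1, w) ∼ γ (1, z)` in `P(ℂ^{1,n})`.

For an `n`-dimensional smooth `ℂ`-scheme `X` the tree speaks of the complex manifold `X^an`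
through Hodge models `A : HodgeModel n X` (carrier `A.carrier`, model space `A.model ≅ ℂⁿ`,
comparison `A.toComplexPoints : A.carrier → X(ℂ)`, unique up to unique biholomorphism over
`X(ℂ)` — `HodgeModel.exists_biholomorph`, Serre GAGA §2 n°5 Prop. 2, proved in the tree).
Accordingly, VERBATIM the inline hypothesis of the route items (with `4 ↦ n`, `5 ↦ n + 1`):

* `MoebiusRel γ z w` (`γ : Matrix (Fin (n+1)) (Fin (n+1)) ℂ`, `z w : ℂⁿ = EuclideanSpace ℂ (Fin n)`):
  the DIVISION-FREE form `wᵢ · (γ₀₀ + ∑ⱼ γ₀,ⱼ₊₁ zⱼ) = γᵢ₊₁,₀ + ∑ⱼ γᵢ₊₁,ⱼ₊₁ zⱼ` (all `i : Fin n`) of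
  "`w = γ · z` in the chart `z₀ = 1`".
* `HodgeModel.IsBallCoveredOff A Z S` (`Z : Set X.left` — a subset of the underlying space of the
  scheme, in the items a Zariski-closed one; `S : Set (Matrix (Fin (n+1)) (Fin (n+1)) ℂ)`): there is
  `π : ℂⁿ → A.carrier`, `ℂ`-differentiable at every point of the open unit ball `𝔹ⁿ` (hermitian
  norm), mapping `𝔹ⁿ` into the OFF-LOCUS `{x : A.carrier | (A.toComplexPoints x).pt ∉ Z}` (the
  analytic open set `(X ∖ Z)^an`) so that the restriction `𝔹ⁿ → (X ∖ Z)^an` is a SURJECTIVE covering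
  map, and whose fibre relation on `𝔹ⁿ` is exactly "`∃ γ ∈ S, w = γ · z`":
  `π z = π w ↔ ∃ γ ∈ S, MoebiusRel γ z w`. Since `𝔹ⁿ` is simply connected, this says
  `(X ∖ Z)^an ≅ Γ \ 𝔹ⁿ` for the group `Γ ⊆ PU(n,1)` of Möbius transformations defined by `S`
  (which must then act freely and properly discontinuously), i.e. `X` is a smooth algebraic variety
  containing the ball quotient `Γ \ 𝔹ⁿ` as the complement of `Z` — for the smooth projective `X` of
  the items: a smooth compactification of `Γ \ 𝔹ⁿ` (and any smooth projective birational model of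
  one in which the quotient survives as an open subset).

API (all proved):
* unfolding (`isBallCoveredOff_iff`, verbatim the item text, `Iff.rfl`;
  `isBallCoveredOff_iff_moebiusRel`);
* sanity of the Möbius formula: the identity matrix relates `z` exactly to itself
  (`moebiusRel_one_iff`), scalar multiples of `γ` define the same relation (`moebiusRel_smul_iff`,
  so only the class of `γ` in `PGL_{n+1}(ℂ)` matters);
* the off-locus is open for closed `Z` (`HodgeModel.isOpen_setOf_pt_notMem`, GAGA) and non-empty
  under the hypothesis (`IsBallCoveredOff.nonempty_setOf_pt_notMem`); only the trace of `Z` on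
  `X(ℂ)` matters (`IsBallCoveredOff.of_forall_mem_iff`), only the relation defined by `S` on the
  ball matters (`IsBallCoveredOff.of_forall_moebiusRel_iff`);
* INDEPENDENCE OF THE HODGE MODEL (`IsBallCoveredOff.of_homeomorph`,
  `IsBallCoveredOff.of_isSmoothProjective`, `isBallCoveredOff_iff_of_isSmoothProjective`): transport
  along the biholomorphism over `X(ℂ)` between two models, which respects the off-loci;
* the fibre relation "`∃ γ ∈ S, w = γ · z`" is an equivalence relation on `𝔹ⁿ`
  (`IsBallCoveredOff.exists_moebiusRel_self` — so some element of `S` fixes each point, typically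
  `1 ∈ S` —, `.moebiusRel_symm`, `.moebiusRel_trans`, `.nonempty`);
* FREENESS forced by the covering condition (`IsBallCoveredOff.exists_ball_forall_eq_of_moebiusRel`:
  near every point of `𝔹ⁿ` two `S`-related points are equal, because a covering map is locally
  injective; `IsBallCoveredOff.eventually_eq_of_moebiusRel`: an element of `S` acting near a point
  `z₀ ∈ 𝔹ⁿ` as a continuous map fixing `z₀` acts as the identity near `z₀` — no elliptic elements);
* the compact case: if no complex point of `X` lies on `Z` (e.g. `Z = ∅`) then `A` is ball-covered
  in the sense of `CompactBallQuotient` and `X` is a compact ball quotient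
  (`IsBallCoveredOff.isBallCovered_of_forall`, `.isBallCovered`, `.isCompactBallQuotient`).

## Design notes (junk analysis)

* `S` is an arbitrary set of matrices: neither invertibility nor `J`-unitarity nor integrality is
  part of the predicate (the items add "entries in `ℤ[ω]`, `γᴴ J γ = J`, `Γ(N) ⊆ S`" as separate
  conjuncts). For a matrix `γ` and a point `z` with `γ (1, z) = 0` the relation `MoebiusRel γ z w`
  holds for EVERY `w` (both sides vanish), and if only the denominator `(γ(1,z))₀` vanishes it holds
  for NO `w`; neither happens for `γ ∈ U(J)` and `z ∈ 𝔹ⁿ` (`γ (1, z)` is a positive vector, whose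
  `0`-th coordinate is non-zero), the only case the items use. By `moebiusRel_smul_iff` the
  predicate sees `S` only through its image in `PGL_{n+1}(ℂ)`, and by the fibre-relation clause only
  through the equivalence relation it defines on `𝔹ⁿ` (`of_forall_moebiusRel_iff`).
* The converse of the compact case, `A.IsBallCovered → ∃ S, A.IsBallCoveredOff ∅ S`, is the
  theorem `Aut(𝔹ⁿ) = PU(n,1)` (every deck transformation is a Möbius transformation) together with
  the surjectivity of the covering (automatic for smooth projective `X`,
  `HodgeModel.surjective_ballRestrict`); it is NOT in the tree and not proved here.
* Surjectivity of the covering is PART of this predicate (Mathlib's `IsCoveringMap` allows empty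
  fibres), as in the items: the off-locus `(X ∖ Z)^an` is then literally the quotient of `𝔹ⁿ` by
  the fibre relation.
* `Z : Set X.left` is a subset of the underlying topological space of the scheme `X.left`
  (generic points included); only closed points matter (`of_forall_mem_iff`), and nothing requires
  `Z` to be Zariski-closed (the items add `IsClosed Z`; then the off-locus is open,
  `HodgeModel.isOpen_setOf_pt_notMem`).
* `n = 0`: `𝔹⁰` is a point and `MoebiusRel γ z w ↔ True` (no coordinates), so the predicate says
  that the off-locus is a single point evenly covered by a point, and `S ≠ ∅`.
* What is NOT here: the group-theoretic repackaging (deck group `= ⟨S⟩ / scalars`, proper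
  discontinuity, torsion-freeness of `⟨S⟩` as an abstract group), Borel's extension theorem and the
  uniqueness of the algebraic structure on `Γ \ 𝔹ⁿ`, toroidal compactifications — later requests
  of the route, not needed to STATE its items.

## References

* D. Allcock, E. Freitag, *Cubic surfaces and Borcherds products*, Comment. Math. Helv. 77
  (2002), §2 (2.1), §3 (3.1).
* D. Allcock, J. Carlson, D. Toledo, *The complex hyperbolic geometry of the moduli space of cubic
  surfaces*, J. Algebraic Geom. 11 (2002).
* N. Bergeron, J. Millson, C. Moeglin, *The Hodge conjecture and arithmetic quotients of complex
  balls*, Acta Math. 216 (2016), §1.1 (arXiv:1306.1515): `S(Γ) = Γ \ X`, "`X` identifies with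
  the unit ball in `ℂᵖ`".
* J.-P. Serre, *GAGA*, Ann. Inst. Fourier 6 (1956), §2 n°5 Prop. 2 (uniqueness of `X^h`).
-/

noncomputable section

open scoped Manifold ContDiff Topology

namespace Literature.AlgebraicGeometry.HodgeTheory

section HodgeTheory

variable {n : ℕ} {X : Motives.SchemeOver ℂ}

/-! ### The division-free Möbius relation in the chart `z₀ = 1` -/

/-- **`w = γ · z` in the affine chart `z₀ = 1`, written division-free.** For a complex
`(n+1) × (n+1)` matrix `γ = (γᵢⱼ)_{0 ≤ i, j ≤ n}` and `z, w ∈ ℂⁿ` (coordinates `z₁, …, zₙ`, read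
through `EuclideanSpace.equiv`): for every `i`,
`wᵢ · (γ₀₀ + ∑ⱼ γ₀ⱼ zⱼ) = γᵢ₀ + ∑ⱼ γᵢⱼ zⱼ`, i.e. `(1, w)` is proportional to `γ (1, z)` whenever the
denominator `(γ (1, z))₀` is non-zero — the projective-linear action of `γ` on `P(ℂ^{1,n})` in the
chart in which the ball of a signature-`(1, n)` hermitian form is `{|z₁|² + ⋯ + |zₙ|² < 1}`.
Spelled exactly as in the items of route `EisensteinMiddleThird`.
[cite: AllcockFreitag2002, §3 (3.1)] -/
def MoebiusRel (γ : Matrix (Fin (n + 1)) (Fin (n + 1)) ℂ) (z w : EuclideanSpace ℂ (Fin n)) : Prop :=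
  ∀ i : Fin n,
    EuclideanSpace.equiv (Fin n) ℂ w i *
        (γ 0 0 + ∑ j : Fin n, γ 0 (Fin.succ j) * EuclideanSpace.equiv (Fin n) ℂ z j) =
      γ (Fin.succ i) 0 + ∑ j : Fin n, γ (Fin.succ i) (Fin.succ j) * EuclideanSpace.equiv (Fin n) ℂ z j

/-- Unfolding lemma for `MoebiusRel`. [cite: AllcockFreitag2002, §3 (3.1)] -/
theorem moebiusRel_iff (γ : Matrix (Fin (n + 1)) (Fin (n + 1)) ℂ) (z w : EuclideanSpace ℂ (Fin n)) :
    MoebiusRel γ z w ↔ ∀ i : Fin n,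
      EuclideanSpace.equiv (Fin n) ℂ w i *
          (γ 0 0 + ∑ j : Fin n, γ 0 (Fin.succ j) * EuclideanSpace.equiv (Fin n) ℂ z j) =
        γ (Fin.succ i) 0 +
          ∑ j : Fin n, γ (Fin.succ i) (Fin.succ j) * EuclideanSpace.equiv (Fin n) ℂ z j :=
  Iff.rfl

/-- **The identity matrix acts as the identity**: `MoebiusRel 1 z w ↔ w = z` (sanity check of the
index conventions: the denominator is `1`, the numerators are the coordinates of `z`). [folklore] -/
theorem moebiusRel_one_iff (z w : EuclideanSpace ℂ (Fin n)) :
    MoebiusRel (1 : Matrix (Fin (n + 1)) (Fin (n + 1)) ℂ) z w ↔ w = z := by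
  have key : ∀ i : Fin n,
      (EuclideanSpace.equiv (Fin n) ℂ w i *
            ((1 : Matrix (Fin (n + 1)) (Fin (n + 1)) ℂ) 0 0 +
              ∑ j : Fin n, (1 : Matrix (Fin (n + 1)) (Fin (n + 1)) ℂ) 0 (Fin.succ j) *
                EuclideanSpace.equiv (Fin n) ℂ z j) =
          (1 : Matrix (Fin (n + 1)) (Fin (n + 1)) ℂ) (Fin.succ i) 0 +
            ∑ j : Fin n, (1 : Matrix (Fin (n + 1)) (Fin (n + 1)) ℂ) (Fin.succ i) (Fin.succ j) *
              EuclideanSpace.equiv (Fin n) ℂ z j) ↔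
        EuclideanSpace.equiv (Fin n) ℂ w i = EuclideanSpace.equiv (Fin n) ℂ z i := by
    intro i
    have h0 : ∀ j : Fin n, (0 : Fin (n + 1)) ≠ Fin.succ j := fun j ↦ (Fin.succ_ne_zero j).symm
    simp [Matrix.one_apply, h0, Fin.succ_ne_zero, Finset.sum_ite_eq]
  constructor
  · intro h
    exact (EuclideanSpace.equiv (Fin n) ℂ).injective (funext fun i ↦ (key i).mp (h i))
  · rintro rfl i
    exact (key i).mpr rfl

/-- **Only the class of `γ` in `PGL_{n+1}(ℂ)` matters**: a non-zero scalar multiple of `γ` defines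
the same relation. [folklore] -/
theorem moebiusRel_smul_iff {c : ℂ} (hc : c ≠ 0) (γ : Matrix (Fin (n + 1)) (Fin (n + 1)) ℂ)
    (z w : EuclideanSpace ℂ (Fin n)) : MoebiusRel (c • γ) z w ↔ MoebiusRel γ z w := by
  refine forall_congr' fun i ↦ ?_
  have h1 : (c • γ) 0 0 + ∑ j : Fin n, (c • γ) 0 (Fin.succ j) * EuclideanSpace.equiv (Fin n) ℂ z j =
      c * (γ 0 0 + ∑ j : Fin n, γ 0 (Fin.succ j) * EuclideanSpace.equiv (Fin n) ℂ z j) := by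
    simp only [Matrix.smul_apply, smul_eq_mul, mul_add, Finset.mul_sum, mul_assoc]
  have h2 : (c • γ) (Fin.succ i) 0 +
        ∑ j : Fin n, (c • γ) (Fin.succ i) (Fin.succ j) * EuclideanSpace.equiv (Fin n) ℂ z j =
      c * (γ (Fin.succ i) 0 +
        ∑ j : Fin n, γ (Fin.succ i) (Fin.succ j) * EuclideanSpace.equiv (Fin n) ℂ z j) := by
    simp only [Matrix.smul_apply, smul_eq_mul, mul_add, Finset.mul_sum, mul_assoc]
  rw [h1, h2]
  constructor
  · intro h
    exact mul_left_cancel₀ hc (by linear_combination h)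
  · intro h
    linear_combination c * h

namespace HodgeModel

/-! ### The off-locus `(X ∖ Z)^an` inside a Hodge model -/

/-- For a Zariski-closed `Z ⊆ X`, the off-locus `{x ∈ X^an | x ∉ Z}` is open in the carrier of a
Hodge model: `U(ℂ) ⊆ X(ℂ)` is open in the analytic topology for every Zariski-open `U`
(`Motives.AlgPoints.isOpen_setOf_pt_mem`, GAGA §2) and the comparison map `X^an → X(ℂ)` is
continuous. [cite: SerreGAGA1956, §2] -/
theorem isOpen_setOf_pt_notMem (A : HodgeModel n X) {Z : Set X.left} (hZ : IsClosed Z) :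
    IsOpen {x : A.carrier | (A.toComplexPoints x).pt ∉ Z} :=
  (Motives.AlgPoints.isOpen_setOf_pt_mem (X := X) (L := ℂ) ⟨Zᶜ, hZ.isOpen_compl⟩).preimage
    A.isAnalytification.isHomeomorph.continuous

/-! ### Ball coverings off `Z` with prescribed deck relation -/

/-- **The Hodge model `A` of `X` is covered by the ball off `Z`, with deck relation generated by
`S`** — "`(X ∖ Z)^an ≅ Γ \ 𝔹ⁿ` with `Γ` the group of Möbius transformations given by the matrices
in `S`": there is a map `π : ℂⁿ → X^an` (`ℂⁿ = EuclideanSpace ℂ (Fin n)`, hermitian norm) which is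
`ℂ`-differentiable at every point of the open unit ball `𝔹ⁿ = {‖z‖ < 1}`, maps `𝔹ⁿ` into the
off-locus `{x | (A.toComplexPoints x).pt ∉ Z} = (X ∖ Z)^an` so that the restriction
`𝔹ⁿ → (X ∖ Z)^an` is a covering map AND surjective, and identifies two points of the ball exactly
when they are `S`-related in the chart `z₀ = 1`: `π z = π w ↔ ∃ γ ∈ S, w = γ · z` (division-free,
`MoebiusRel`). This is the shape "`S(Γ) = Γ \ X`, `X` the unit ball in `ℂⁿ`" of an arithmetic ball
quotient sitting inside a smooth variety `X` as the complement of `Z` (e.g. a smooth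
compactification of a non-compact Picard-modular ball quotient such as the moduli space of cubic
surfaces `Aut(𝓔^{1,4}) \ 𝓑⁴`). VERBATIM the inline hypothesis of the items of route
`EisensteinMiddleThird` (`isBallCoveredOff_iff` is `Iff.rfl`); the values of `π` off the ball are
irrelevant. [cite: BergeronMillsonMoeglin2016Balls, §1.1] -/
def IsBallCoveredOff (A : HodgeModel n X) (Z : Set X.left)
    (S : Set (Matrix (Fin (n + 1)) (Fin (n + 1)) ℂ)) : Prop :=
  ∃ π : EuclideanSpace ℂ (Fin n) → A.carrier,
    (∀ z ∈ Metric.ball (0 : EuclideanSpace ℂ (Fin n)) 1,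
      MDifferentiableAt 𝓘(ℂ, EuclideanSpace ℂ (Fin n)) 𝓘(ℂ, A.model) π z) ∧
    (∃ h : Set.MapsTo π (Metric.ball (0 : EuclideanSpace ℂ (Fin n)) 1)
        {x : A.carrier | (A.toComplexPoints x).pt ∉ Z},
      IsCoveringMap h.restrict ∧ Function.Surjective h.restrict) ∧
    (∀ z ∈ Metric.ball (0 : EuclideanSpace ℂ (Fin n)) 1,
      ∀ w ∈ Metric.ball (0 : EuclideanSpace ℂ (Fin n)) 1,
        π z = π w ↔ ∃ γ ∈ S, ∀ i : Fin n,
          EuclideanSpace.equiv (Fin n) ℂ w i *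
              (γ 0 0 + ∑ j : Fin n, γ 0 (Fin.succ j) * EuclideanSpace.equiv (Fin n) ℂ z j) =
            γ (Fin.succ i) 0 +
              ∑ j : Fin n, γ (Fin.succ i) (Fin.succ j) * EuclideanSpace.equiv (Fin n) ℂ z j)

/-- Unfolding lemma for `HodgeModel.IsBallCoveredOff`: verbatim the inline hypothesis of the route
items (with `4 ↦ n`, `Fin 5 ↦ Fin (n + 1)`). [cite: BergeronMillsonMoeglin2016Balls, §1.1] -/
theorem isBallCoveredOff_iff (A : HodgeModel n X) (Z : Set X.left)
    (S : Set (Matrix (Fin (n + 1)) (Fin (n + 1)) ℂ)) :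
    A.IsBallCoveredOff Z S ↔
      ∃ π : EuclideanSpace ℂ (Fin n) → A.carrier,
        (∀ z ∈ Metric.ball (0 : EuclideanSpace ℂ (Fin n)) 1,
          MDifferentiableAt 𝓘(ℂ, EuclideanSpace ℂ (Fin n)) 𝓘(ℂ, A.model) π z) ∧
        (∃ h : Set.MapsTo π (Metric.ball (0 : EuclideanSpace ℂ (Fin n)) 1)
            {x : A.carrier | (A.toComplexPoints x).pt ∉ Z},
          IsCoveringMap h.restrict ∧ Function.Surjective h.restrict) ∧
        (∀ z ∈ Metric.ball (0 : EuclideanSpace ℂ (Fin n)) 1,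
          ∀ w ∈ Metric.ball (0 : EuclideanSpace ℂ (Fin n)) 1,
            π z = π w ↔ ∃ γ ∈ S, ∀ i : Fin n,
              EuclideanSpace.equiv (Fin n) ℂ w i *
                  (γ 0 0 + ∑ j : Fin n, γ 0 (Fin.succ j) * EuclideanSpace.equiv (Fin n) ℂ z j) =
                γ (Fin.succ i) 0 +
                  ∑ j : Fin n, γ (Fin.succ i) (Fin.succ j) *
                    EuclideanSpace.equiv (Fin n) ℂ z j) :=
  Iff.rfl

/-- `HodgeModel.IsBallCoveredOff` with the fibre relation written through `MoebiusRel`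
(definitionally the same). [cite: BergeronMillsonMoeglin2016Balls, §1.1] -/
theorem isBallCoveredOff_iff_moebiusRel (A : HodgeModel n X) (Z : Set X.left)
    (S : Set (Matrix (Fin (n + 1)) (Fin (n + 1)) ℂ)) :
    A.IsBallCoveredOff Z S ↔
      ∃ π : EuclideanSpace ℂ (Fin n) → A.carrier,
        (∀ z ∈ Metric.ball (0 : EuclideanSpace ℂ (Fin n)) 1,
          MDifferentiableAt 𝓘(ℂ, EuclideanSpace ℂ (Fin n)) 𝓘(ℂ, A.model) π z) ∧
        (∃ h : Set.MapsTo π (Metric.ball (0 : EuclideanSpace ℂ (Fin n)) 1)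
            {x : A.carrier | (A.toComplexPoints x).pt ∉ Z},
          IsCoveringMap h.restrict ∧ Function.Surjective h.restrict) ∧
        (∀ z ∈ Metric.ball (0 : EuclideanSpace ℂ (Fin n)) 1,
          ∀ w ∈ Metric.ball (0 : EuclideanSpace ℂ (Fin n)) 1,
            π z = π w ↔ ∃ γ ∈ S, MoebiusRel γ z w) :=
  Iff.rfl

variable {A : HodgeModel n X} {Z : Set X.left} {S : Set (Matrix (Fin (n + 1)) (Fin (n + 1)) ℂ)}

namespace IsBallCoveredOff

/-- The off-locus `(X ∖ Z)^an` of a ball-covered-off-`Z` model is non-empty (it contains `π 0`);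
in particular `Z` does not contain every complex point of `X`. [folklore] -/
theorem nonempty_setOf_pt_notMem (hA : A.IsBallCoveredOff Z S) :
    {x : A.carrier | (A.toComplexPoints x).pt ∉ Z}.Nonempty := by
  obtain ⟨π, -, ⟨hmaps, -, -⟩, -⟩ := hA
  exact ⟨π 0, hmaps (Metric.mem_ball_self one_pos)⟩

/-- Only the trace of `Z` on the complex points matters: if `Z` and `Z'` contain the same closed
points `(A.toComplexPoints x).pt`, the two predicates agree. [folklore] -/
theorem of_forall_mem_iff (hA : A.IsBallCoveredOff Z S) {Z' : Set X.left}
    (hZZ' : ∀ x : A.carrier, (A.toComplexPoints x).pt ∈ Z ↔ (A.toComplexPoints x).pt ∈ Z') :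
    A.IsBallCoveredOff Z' S := by
  have hset : {x : A.carrier | (A.toComplexPoints x).pt ∉ Z} =
      {x : A.carrier | (A.toComplexPoints x).pt ∉ Z'} :=
    Set.ext fun x ↦ not_congr (hZZ' x)
  obtain ⟨π, hπ, hcov, hdeck⟩ := hA
  refine ⟨π, hπ, ?_, hdeck⟩
  rw [← hset]
  exact hcov

/-- Only the relation defined by `S` on the ball matters: if `S` and `S'` relate the same pairs of
points of `𝔹ⁿ` (e.g. `S' = S ∪ {1}`, or `S'` = the non-zero scalar multiples of `S`,
`moebiusRel_smul_iff`), the two predicates agree. [folklore] -/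
theorem of_forall_moebiusRel_iff (hA : A.IsBallCoveredOff Z S)
    {S' : Set (Matrix (Fin (n + 1)) (Fin (n + 1)) ℂ)}
    (hSS' : ∀ z ∈ Metric.ball (0 : EuclideanSpace ℂ (Fin n)) 1,
      ∀ w ∈ Metric.ball (0 : EuclideanSpace ℂ (Fin n)) 1,
        (∃ γ ∈ S, MoebiusRel γ z w) ↔ ∃ γ ∈ S', MoebiusRel γ z w) :
    A.IsBallCoveredOff Z S' := by
  obtain ⟨π, hπ, hcov, hdeck⟩ := hA
  exact ⟨π, hπ, hcov, fun z hz w hw ↦ (hdeck z hz w hw).trans (hSS' z hz w hw)⟩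

/-! ### Independence of the Hodge model -/

/-- **Transport along a holomorphic homeomorphism over `X(ℂ)`.** If `A` is covered by the ball off
`Z` with deck relation `S` via `π`, and `e : A.carrier ≃ₜ A'.carrier` is holomorphic and commutes
with the comparison maps to `X(ℂ)`, then so is `A'`, via `e ∘ π`: `e` restricts to a homeomorphism
of the off-loci (it respects `toComplexPoints`), a homeomorphism composed with a (surjective)
covering map is a (surjective) covering map (`IsCoveringMap.homeomorph_comp`), holomorphy by the
chain rule, and `e` is injective so the fibre relation is unchanged. [folklore] -/
theorem of_homeomorph {A' : HodgeModel n X} (hA : A.IsBallCoveredOff Z S)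
    (e : A.carrier ≃ₜ A'.carrier) (he : MDifferentiable 𝓘(ℂ, A.model) 𝓘(ℂ, A'.model) e)
    (hcomm : A'.toComplexPoints ∘ e = A.toComplexPoints) : A'.IsBallCoveredOff Z S := by
  obtain ⟨π, hπ, ⟨hmaps, hcov, hsurj⟩, hdeck⟩ := hA
  have hpt : ∀ x, A'.toComplexPoints (e x) = A.toComplexPoints x := fun x ↦ congrFun hcomm x
  let eZ : {x : A.carrier | (A.toComplexPoints x).pt ∉ Z} ≃ₜ
      {x : A'.carrier | (A'.toComplexPoints x).pt ∉ Z} :=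
    e.subtype fun x ↦ by simp only [Set.mem_setOf_eq, hpt]
  have hmaps' : Set.MapsTo (e ∘ π) (Metric.ball (0 : EuclideanSpace ℂ (Fin n)) 1)
      {x : A'.carrier | (A'.toComplexPoints x).pt ∉ Z} := fun z hz ↦ by
    simp only [Set.mem_setOf_eq, Function.comp_apply, hpt]
    exact hmaps hz
  have hrestr : hmaps'.restrict = eZ ∘ hmaps.restrict := funext fun _ ↦ rfl
  refine ⟨e ∘ π, fun z hz ↦ (he (π z)).comp z (hπ z hz), ⟨hmaps', ?_, ?_⟩, fun z hz w hw ↦ ?_⟩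
  · rw [hrestr]
    exact hcov.homeomorph_comp eZ
  · rw [hrestr]
    exact eZ.surjective.comp hsurj
  · rw [← hdeck z hz w hw]
    exact e.injective.eq_iff

/-- **Independence of the Hodge model.** For a smooth projective `X`, if ONE Hodge model is covered
by the ball off `Z` with deck relation `S` then EVERY Hodge model is: two Hodge models differ by a
biholomorphism over `X(ℂ)` (`HodgeModel.exists_biholomorph`, the uniqueness of the
analytification, Serre GAGA §2 n°5 Prop. 2, proved in the tree), along which the datum is
transported (`IsBallCoveredOff.of_homeomorph`).
[cite: SerreGAGA1956, §2 n°5 Prop. 2 (unicité de X^h)] -/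
theorem of_isSmoothProjective (hX : Motives.IsSmoothProjective n X) (hA : A.IsBallCoveredOff Z S)
    (A' : HodgeModel n X) : A'.IsBallCoveredOff Z S := by
  obtain ⟨e, he, -, hcomm⟩ := HodgeModel.exists_biholomorph hX A A'
  exact hA.of_homeomorph e he hcomm

end IsBallCoveredOff

/-- **`∃` and `∀` over Hodge models agree**: for a smooth projective `X` and any two Hodge models
`A`, `A'`, `A` is covered by the ball off `Z` with deck relation `S` iff `A'` is.
[cite: SerreGAGA1956, §2 n°5 Prop. 2 (unicité de X^h)] -/
theorem isBallCoveredOff_iff_of_isSmoothProjective (hX : Motives.IsSmoothProjective n X)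
    (A A' : HodgeModel n X) (Z : Set X.left) (S : Set (Matrix (Fin (n + 1)) (Fin (n + 1)) ℂ)) :
    A.IsBallCoveredOff Z S ↔ A'.IsBallCoveredOff Z S :=
  ⟨fun h ↦ h.of_isSmoothProjective hX A', fun h ↦ h.of_isSmoothProjective hX A⟩

namespace IsBallCoveredOff

/-! ### The fibre relation is an equivalence relation on the ball; freeness -/

/-- Reflexivity of the fibre relation: every point of the ball is `S`-related to itself, i.e. some
`γ ∈ S` (typically `γ = 1`, cf. `moebiusRel_one_iff`) fixes it. [folklore] -/
theorem exists_moebiusRel_self (hA : A.IsBallCoveredOff Z S) {z : EuclideanSpace ℂ (Fin n)}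
    (hz : z ∈ Metric.ball (0 : EuclideanSpace ℂ (Fin n)) 1) : ∃ γ ∈ S, MoebiusRel γ z z := by
  obtain ⟨π, -, -, hdeck⟩ := hA
  exact (hdeck z hz z hz).mp rfl

/-- In particular `S` is non-empty (the ball contains `0`). [folklore] -/
theorem nonempty (hA : A.IsBallCoveredOff Z S) : S.Nonempty := by
  obtain ⟨γ, hγ, -⟩ := hA.exists_moebiusRel_self (Metric.mem_ball_self one_pos)
  exact ⟨γ, hγ⟩

/-- Symmetry of the fibre relation on the ball (it is the kernel relation of `π`). [folklore] -/
theorem moebiusRel_symm (hA : A.IsBallCoveredOff Z S) {z w : EuclideanSpace ℂ (Fin n)}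
    (hz : z ∈ Metric.ball (0 : EuclideanSpace ℂ (Fin n)) 1)
    (hw : w ∈ Metric.ball (0 : EuclideanSpace ℂ (Fin n)) 1) (h : ∃ γ ∈ S, MoebiusRel γ z w) :
    ∃ γ ∈ S, MoebiusRel γ w z := by
  obtain ⟨π, -, -, hdeck⟩ := hA
  exact (hdeck w hw z hz).mp ((hdeck z hz w hw).mpr h).symm

/-- Transitivity of the fibre relation on the ball (it is the kernel relation of `π`). [folklore] -/
theorem moebiusRel_trans (hA : A.IsBallCoveredOff Z S) {z w v : EuclideanSpace ℂ (Fin n)}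
    (hz : z ∈ Metric.ball (0 : EuclideanSpace ℂ (Fin n)) 1)
    (hw : w ∈ Metric.ball (0 : EuclideanSpace ℂ (Fin n)) 1)
    (hv : v ∈ Metric.ball (0 : EuclideanSpace ℂ (Fin n)) 1) (h₁ : ∃ γ ∈ S, MoebiusRel γ z w)
    (h₂ : ∃ γ ∈ S, MoebiusRel γ w v) : ∃ γ ∈ S, MoebiusRel γ z v := by
  obtain ⟨π, -, -, hdeck⟩ := hA
  exact (hdeck z hz v hv).mp (((hdeck z hz w hw).mpr h₁).trans ((hdeck w hw v hv).mpr h₂))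

/-- **Freeness / discreteness forced by the covering condition.** Around every point `z₀` of the
ball there is a smaller ball, inside `𝔹ⁿ`, in which two `S`-related points are EQUAL: a covering
map is a local homeomorphism, hence locally injective (`IsLocalHomeomorph.isLocallyInjective`), and
`S`-related points have the same image. So no element of `S` moves a point near `z₀` to another
point near `z₀` (no elliptic elements, locally finite orbits). [folklore] -/
theorem exists_ball_forall_eq_of_moebiusRel (hA : A.IsBallCoveredOff Z S)
    {z₀ : EuclideanSpace ℂ (Fin n)} (hz₀ : z₀ ∈ Metric.ball (0 : EuclideanSpace ℂ (Fin n)) 1) :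
    ∃ ε > 0, Metric.ball z₀ ε ⊆ Metric.ball (0 : EuclideanSpace ℂ (Fin n)) 1 ∧
      ∀ z ∈ Metric.ball z₀ ε, ∀ w ∈ Metric.ball z₀ ε, (∃ γ ∈ S, MoebiusRel γ z w) → z = w := by
  obtain ⟨π, -, ⟨hmaps, hcov, -⟩, hdeck⟩ := hA
  obtain ⟨U, hUo, hzU, hinj⟩ := hcov.isLocalHomeomorph.isLocallyInjective ⟨z₀, hz₀⟩
  obtain ⟨V, hVo, hVU⟩ := isOpen_induced_iff.mp hUo
  have hzV : z₀ ∈ V ∩ Metric.ball (0 : EuclideanSpace ℂ (Fin n)) 1 := by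
    refine ⟨?_, hz₀⟩
    rw [← hVU] at hzU
    exact hzU
  obtain ⟨ε, hε, hball⟩ := Metric.isOpen_iff.mp (hVo.inter Metric.isOpen_ball) z₀ hzV
  refine ⟨ε, hε, fun z hz ↦ (hball hz).2, fun z hz w hw hrel ↦ ?_⟩
  have hz1 : z ∈ Metric.ball (0 : EuclideanSpace ℂ (Fin n)) 1 := (hball hz).2
  have hw1 : w ∈ Metric.ball (0 : EuclideanSpace ℂ (Fin n)) 1 := (hball hw).2
  have hπ : π z = π w := (hdeck z hz1 w hw1).mpr hrel
  have hzU' : (⟨z, hz1⟩ : Metric.ball (0 : EuclideanSpace ℂ (Fin n)) 1) ∈ U := by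
    rw [← hVU]
    exact (hball hz).1
  have hwU' : (⟨w, hw1⟩ : Metric.ball (0 : EuclideanSpace ℂ (Fin n)) 1) ∈ U := by
    rw [← hVU]
    exact (hball hw).1
  exact congrArg Subtype.val (hinj hzU' hwU' (Subtype.ext hπ))

/-- **An element of `S` with a fixed point acts trivially near it.** If `γ ∈ S` acts near
`z₀ ∈ 𝔹ⁿ` as a map `f` (`MoebiusRel γ z (f z)` for `z` near `z₀`) which is continuous at `z₀` and
fixes `z₀`, then `f z = z` for all `z` near `z₀` — the "torsion-freeness forced by the covering
condition": the Möbius transformations in `S` have no fixed points in the ball unless they are the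
identity nearby. [folklore] -/
theorem eventually_eq_of_moebiusRel (hA : A.IsBallCoveredOff Z S)
    {γ : Matrix (Fin (n + 1)) (Fin (n + 1)) ℂ} (hγ : γ ∈ S) {z₀ : EuclideanSpace ℂ (Fin n)}
    (hz₀ : z₀ ∈ Metric.ball (0 : EuclideanSpace ℂ (Fin n)) 1)
    {f : EuclideanSpace ℂ (Fin n) → EuclideanSpace ℂ (Fin n)} (hf : ContinuousAt f z₀)
    (hfz₀ : f z₀ = z₀) (hrel : ∀ᶠ z in 𝓝 z₀, MoebiusRel γ z (f z)) :
    ∀ᶠ z in 𝓝 z₀, f z = z := by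
  obtain ⟨ε, hε, -, hfree⟩ := hA.exists_ball_forall_eq_of_moebiusRel hz₀
  have h1 : Metric.ball z₀ ε ∈ 𝓝 z₀ := Metric.ball_mem_nhds z₀ hε
  have h2 : f ⁻¹' Metric.ball z₀ ε ∈ 𝓝 z₀ :=
    hf.preimage_mem_nhds (by rw [hfz₀]; exact Metric.ball_mem_nhds z₀ hε)
  filter_upwards [h1, h2, hrel] with z hz hfz hr
  exact (hfree z hz (f z) hfz ⟨γ, hγ, hr⟩).symm

/-! ### The compact case `Z = ∅` -/

/-- **If no complex point of `X` lies on `Z`, the model is ball-covered** in the sense of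
`CompactBallQuotient`: the off-locus is then all of `X^an`, and the covering `𝔹ⁿ → (X ∖ Z)^an`
composed with the homeomorphism `(X ∖ Z)^an = X^an` is a covering of `X^an` (forget surjectivity
and the deck relation). [cite: BergeronMillsonMoeglin2016Balls, §1.1] -/
theorem isBallCovered_of_forall (hA : A.IsBallCoveredOff Z S)
    (hZ : ∀ x : A.carrier, (A.toComplexPoints x).pt ∉ Z) : A.IsBallCovered := by
  obtain ⟨π, hπ, ⟨hmaps, hcov, -⟩, -⟩ := hA
  let eU : {x : A.carrier | (A.toComplexPoints x).pt ∉ Z} ≃ₜ A.carrier :=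
    (Homeomorph.setCongr (Set.eq_univ_of_forall hZ)).trans (Homeomorph.Set.univ A.carrier)
  have hrestr : (Metric.ball (0 : EuclideanSpace ℂ (Fin n)) 1).restrict π = eU ∘ hmaps.restrict :=
    funext fun _ ↦ rfl
  refine ⟨π, hπ, ?_⟩
  rw [hrestr]
  exact hcov.homeomorph_comp eU

/-- **The case `Z = ∅`**: a Hodge model covered by the ball off `∅` (with any deck relation) is
ball-covered. The converse — every ball covering has a Möbius deck relation — is
`Aut(𝔹ⁿ) = PU(n,1)`, not proved here. [cite: BergeronMillsonMoeglin2016Balls, §1.1] -/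
theorem isBallCovered (hA : A.IsBallCoveredOff ∅ S) : A.IsBallCovered :=
  hA.isBallCovered_of_forall fun _ ↦ Set.notMem_empty _

/-- **The case `Z = ∅`**: `X` is then a compact ball quotient (`IsCompactBallQuotient n X` of
`CompactBallQuotient`, the hypothesis of route `SiuRepresentability`).
[cite: BergeronMillsonMoeglin2016Balls, §1.1] -/
theorem isCompactBallQuotient (hA : A.IsBallCoveredOff ∅ S) : IsCompactBallQuotient n X :=
  hA.isBallCovered.isCompactBallQuotient

end IsBallCoveredOff

end HodgeModel

end HodgeTheory

end Literature.AlgebraicGeometry.HodgeTheory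

end
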